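import Summits.QuantumFields.GaugeBoot.DiagonalRPTorusTwoZigzagAction
import HarnessLib

/-!
# Diagonal RP on the ODD two-dimensional torus, I: the middle zigzag and its rotation gauge
(gauge-boot, task L3(θ))

HONEST FRAMING (cell `pub-gaugeboot`, page 1 of every file): the venture produces certified bounds
on lattice expectations at stated coupling, gauge group, dimension and torus size; NOT a mass gap,
NOT a continuum limit, NOT a string tension; NOT Yang–Mills-summit-bearing (barriers
`FixedCouplingUltralocality`, `PerturbativeInvisibility`). This module is part of a small POSITIVE
structural result about which positivity constraints a two-dimensional TORUS certificate may use
(no two-dimensional certificate with a diagonal block exists or is planned); it discharges nothing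
else.

Setting of `DiagonalRPTorusTwoGeometry.lean`: the square torus `(ℤ/L)²`, the diagonal coordinate
`k = y_i - y_j ∈ ℤ/L` (`kd`), the swap `Θ` (`configDiagSwap`), `c = L/2` (`cc`). Here `L` is ODD,
`L = 2c + 1`, so that `-c = c + 1`: the swap exchanges the layers `c` and `c + 1`, and the
`2L` links between them — the MIDDLE ZIGZAG `A_0 → B_0 → A_1 → B_1 → ⋯ → A_{L-1} → B_{L-1} → A_0`,
`A_t = (c + t) e_i + t e_j` (layer `c`), `B_t = A_t + e_i` (layer `c + 1`), links `(A_t, i)` and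
`(B_t, j)` — are mapped onto themselves: `θ(A_t, i) = (B_{t+c}, j)`, `θ(B_t, j) = (A_{t+c+1}, i)`,
the ROTATION of this `2L`-cycle by `L` links. Since `L` is odd, the rotation exchanges the two
vertex classes.

* `ZM i j e` — `e` is a link of the middle zigzag; `mA i t` — the site `A_t`; the swap on the
  zigzag sites and links (`siteDiagSwap_mA`, `edgeDiagSwap_mA`, `edgeDiagSwap_mA_shift`); every
  zigzag link is `(A_t, i)` or `(B_t, j)` (`exists_eq_of_zm`); zigzag links are not links of the
  closed half `0 ≤ k ≤ c` (`not_inHalf_of_zm`).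
* The partial holonomies `R_t = C_{A_0} ⋯ C_{A_{t-1}}` (`oR`) and the ROTATION GAUGE `h(U)`
  (`ohA`, `ohB`, `ohfun`) with `h(A_t) U(A_t,i) h(B_t)⁻¹ = U(θ(A_t,i))` and
  `h(B_t) U(B_t,j) h(A_{t+1})⁻¹ = U(θ(B_t,j))` (`gauge_mA`, `gauge_mB`): on a cycle any rotation of
  a link configuration is a vertex gauge transform of it (the odd twin of `gauge_zA` / `gauge_zB`
  of `DiagonalRPTorusTwoZigzag.lean`).

Continued in `DiagonalRPTorusOddAction.lean` (the fibrewise vertex action on the middle zigzag and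
the identity `Θ = zig_{h(U)} ∘ Θ″`), `DiagonalRPTorusOddAverage.lean`, `DiagonalRPTorusOddCrossing.lean`
and `DiagonalRPTorusOdd.lean` (the theorem: closed-half diagonal RP holds on odd two-tori for all
observables). All statements are elementary and proved (gauge orbits on a cycle graph; E. Seiler,
LNP 159 (1982) Ch. 2).
-/

open MeasureTheory Complex Finset Function
open scoped ComplexOrder ENNReal

namespace Summit.QuantumFields.GaugeBoot

open Literature.MathematicalPhysics.QuantumFieldTheory

noncomputable section

namespace DiagRPTwo

/-! ## Arithmetic of the diagonal coordinate on the odd torus -/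

section OddLayers

variable {L : ℕ}

/-- `c` has representative `L/2` (every `L ≥ 1`). -/
theorem cc_val' [NeZero L] : (cc L).val = L / 2 := by
  rw [cc, ZMod.val_natCast]
  exact Nat.mod_eq_of_lt (Nat.div_lt_self (Nat.pos_of_ne_zero (NeZero.ne L)) one_lt_two)

/-- `1` has representative `1` (`L ≥ 3`). -/
theorem val_one_of_three_le (h3 : 3 ≤ L) : (1 : ZMod L).val = 1 := by
  haveI : Fact (1 < L) := ⟨by omega⟩
  exact ZMod.val_one L

/-- `ZMod L` is non-trivial for `L ≥ 3` (so that `(1 : ZMod L) ≠ 0` is Mathlib's `one_ne_zero`). -/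
theorem nontrivial_zmod_of_three_le (h3 : 3 ≤ L) : Nontrivial (ZMod L) := by
  haveI : Fact (1 < L) := ⟨by omega⟩
  infer_instance

/-- `c + 1` has representative `L/2 + 1` (`L ≥ 3`). -/
theorem val_cc_add_one' (h3 : 3 ≤ L) : (cc L + 1).val = L / 2 + 1 := by
  haveI : NeZero L := ⟨by omega⟩
  rw [ZMod.val_add_of_lt, cc_val', val_one_of_three_le h3]
  rw [cc_val', val_one_of_three_le h3]
  omega

/-- `c - 1` has representative `L/2 - 1` (`L ≥ 3`). -/
theorem val_cc_sub_one' (h3 : 3 ≤ L) : (cc L - 1).val = L / 2 - 1 := by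
  haveI : NeZero L := ⟨by omega⟩
  rw [ZMod.val_sub, cc_val', val_one_of_three_le h3]
  rw [cc_val', val_one_of_three_le h3]
  omega

/-- `c + 1 ≠ c` (`L ≥ 3`). -/
theorem cc_add_one_ne_cc (h3 : 3 ≤ L) : cc L + 1 ≠ cc L := by
  intro h
  haveI := nontrivial_zmod_of_three_le h3
  exact absurd (by simpa using congrArg (fun z => z - cc L) h : (1 : ZMod L) = 0) one_ne_zero

/-- `c ≠ 0` (`L ≥ 3`). -/
theorem cc_ne_zero' (h3 : 3 ≤ L) : cc L ≠ 0 := by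
  haveI : NeZero L := ⟨by omega⟩
  intro h
  have := cc_val' (L := L)
  rw [h, ZMod.val_zero] at this
  omega

/-- `c + 1 ≠ 0` (`L ≥ 3`). -/
theorem cc_add_one_ne_zero (h3 : 3 ≤ L) : cc L + 1 ≠ 0 := by
  intro h
  have := val_cc_add_one' h3
  rw [h, ZMod.val_zero] at this
  omega

/-- `-c = c + 1` for odd `L`: the swap carries the layer `c` onto the layer `c + 1`. -/
theorem neg_cc_odd (hL : Odd L) : -cc L = cc L + 1 := by
  obtain ⟨r, hr⟩ := hL
  refine neg_eq_of_add_eq_zero_right ?_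
  rw [cc, ← add_assoc, ← Nat.cast_add, ← Nat.cast_add_one,
    show L / 2 + L / 2 + 1 = L by omega, ZMod.natCast_self]

/-- `-(c + 1) = c` for odd `L`. -/
theorem neg_cc_add_one_odd (hL : Odd L) : -(cc L + 1) = cc L := by
  rw [← neg_cc_odd hL, neg_neg]

/-- `2 (L/2) + 1 = L` for odd `L`. -/
theorem two_mul_div_two_add_one (hL : Odd L) : L / 2 + L / 2 + 1 = L := by
  obtain ⟨r, hr⟩ := hL; omega

/-- The cast of `L/2 + (L/2 + 1)` vanishes (odd `L`). -/
theorem cc_add_cc_add_one (hL : Odd L) : cc L + (cc L + 1) = 0 := by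
  rw [← neg_cc_odd hL, add_neg_cancel]

end OddLayers

/-! ## The middle zigzag -/

section Zigzag

variable {L : ℕ} {i j : Fin 2}

variable (i j) in
/-- `e` is a link of the MIDDLE ZIGZAG: a link `(y, i)` based in the layer `c` (running to the
layer `c + 1`) or a link `(y, j)` based in the layer `c + 1` (running to the layer `c`).
[shape] A parametric definition of a proposition — NOT a fact. [folklore] -/
def ZM (e : Edge 2 L) : Prop := (e.2 = i ∧ kd i j e.1 = cc L) ∨ (e.2 = j ∧ kd i j e.1 = cc L + 1)

/-- `ZM` is decidable. -/
instance decZM (i j : Fin 2) : DecidablePred (ZM (L := L) i j) := fun e => by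
  unfold ZM; infer_instance

/-- The layers of the two endpoints of a zigzag link. -/
theorem zm_layers (hij : i ≠ j) {e : Edge 2 L} (he : ZM i j e) :
    (kd i j e.1 = cc L ∧ kd i j (e.1.shift e.2) = cc L + 1) ∨
      (kd i j e.1 = cc L + 1 ∧ kd i j (e.1.shift e.2) = cc L) := by
  rcases he with ⟨h2, hk⟩ | ⟨h2, hk⟩
  · left; exact ⟨hk, by rw [h2, kd_shift_left hij, hk]⟩
  · right; exact ⟨hk, by rw [h2, kd_shift_right hij, hk, add_sub_cancel_right]⟩

/-- A zigzag link is not a link of the closed half (`L ≥ 3`): one endpoint lies in the layer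
`c + 1`. -/
theorem not_inHalf_of_zm [NeZero L] (h3 : 3 ≤ L) (hij : i ≠ j) {e : Edge 2 L} (he : ZM i j e) :
    ¬InHalf i j e := by
  intro hh
  rcases zm_layers hij he with ⟨_, h2⟩ | ⟨h1, _⟩
  · have := hh.2; rw [h2, val_cc_add_one' h3] at this; omega
  · have := hh.1; rw [h1, val_cc_add_one' h3] at this; omega

/-- The swap maps the middle zigzag onto itself (odd `L`). -/
theorem zm_edgeDiagSwap_iff (hL : Odd L) (hij : i ≠ j) (e : Edge 2 L) :
    ZM i j (edgeDiagSwap i j e) ↔ ZM i j e := by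
  obtain ⟨y, μ⟩ := e
  simp only [ZM, edgeDiagSwap, kd_siteDiagSwap, Equiv.swap_apply_eq_iff, Equiv.swap_apply_left,
    Equiv.swap_apply_right]
  constructor
  · rintro (⟨rfl, hk⟩ | ⟨rfl, hk⟩)
    · right; exact ⟨rfl, by rw [← neg_neg (kd i μ y), hk, neg_cc_odd hL]⟩
    · left; exact ⟨rfl, by rw [← neg_neg (kd μ j y), hk, neg_cc_add_one_odd hL]⟩
  · rintro (⟨rfl, hk⟩ | ⟨rfl, hk⟩)
    · right; exact ⟨rfl, by rw [hk, neg_cc_odd hL]⟩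
    · left; exact ⟨rfl, by rw [hk, neg_cc_add_one_odd hL]⟩

variable (i) in
/-- `A_t = (c + t) e_i + t e_j`, the `t`-th site of the layer `c` (`t` taken mod `L`). -/
def mA (t : ℕ) : Site 2 L := fun k => if k = i then cc L + (t : ZMod L) else (t : ZMod L)

/-- The `i`-coordinate of `A_t`. -/
@[simp] theorem mA_apply_left (t : ℕ) : mA (L := L) i t i = cc L + (t : ZMod L) := by simp [mA]

/-- The `j`-coordinate of `A_t`. -/
@[simp] theorem mA_apply_right (hij : i ≠ j) (t : ℕ) : mA (L := L) i t j = (t : ZMod L) := by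
  simp [mA, hij.symm]

/-- `A_t` lies in the layer `c`. -/
theorem kd_mA (hij : i ≠ j) (t : ℕ) : kd i j (mA (L := L) i t) = cc L := by
  rw [kd, mA_apply_left, mA_apply_right hij]; ring

/-- `B_t = A_t + e_i` lies in the layer `c + 1`. -/
theorem kd_mA_shift (hij : i ≠ j) (t : ℕ) : kd i j ((mA (L := L) i t).shift i) = cc L + 1 := by
  rw [kd_shift_left hij, kd_mA hij]

/-- `A_{t+L} = A_t`. -/
theorem mA_add_L (t : ℕ) : mA i (t + L) = mA (L := L) i t := by
  funext k
  simp only [mA, Nat.cast_add, ZMod.natCast_self, add_zero]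

/-- `B_t + e_j = A_{t+1}`. -/
theorem mA_shift_shift (hij : i ≠ j) (t : ℕ) :
    ((mA i t).shift i).shift j = mA (L := L) i (t + 1) := by
  funext k
  obtain hk | hk := ((by decide : ∀ a b c : Fin 2, a ≠ b → c = a ∨ c = b) i j k hij) <;> rw [hk]
  · have h1 : (Pi.single j (1 : ZMod L) : Fin 2 → ZMod L) i = 0 := Pi.single_eq_of_ne hij _
    simp only [Site.shift, mA, Pi.add_apply, Pi.single_eq_same, h1, ↓reduceIte, Nat.cast_add,
      Nat.cast_one]
    ring
  · have h1 : (Pi.single i (1 : ZMod L) : Fin 2 → ZMod L) j = 0 := Pi.single_eq_of_ne' hij _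
    simp only [Site.shift, mA, Pi.add_apply, Pi.single_eq_same, h1, if_neg hij.symm, Nat.cast_add,
      Nat.cast_one, add_zero]

/-- `(A_t, i)` is a zigzag link. -/
theorem zm_mA (hij : i ≠ j) (t : ℕ) : ZM i j (mA (L := L) i t, i) := Or.inl ⟨rfl, kd_mA hij t⟩

/-- `(B_t, j)` is a zigzag link. -/
theorem zm_mA_shift (hij : i ≠ j) (t : ℕ) : ZM i j ((mA (L := L) i t).shift i, j) :=
  Or.inr ⟨rfl, kd_mA_shift hij t⟩

/-- **`θ A_t = B_{t+c}`** (odd `L`). -/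
theorem siteDiagSwap_mA (hL : Odd L) (hij : i ≠ j) (t : ℕ) :
    siteDiagSwap i j (mA (L := L) i t) = (mA i (t + L / 2)).shift i := by
  funext k
  obtain hk | hk := ((by decide : ∀ a b c : Fin 2, a ≠ b → c = a ∨ c = b) i j k hij) <;> rw [hk]
  · rw [WilsonRP.shift_apply_self, siteDiagSwap, Equiv.swap_apply_left, mA_apply_right hij,
      mA_apply_left, Nat.cast_add, show ((L / 2 : ℕ) : ZMod L) = cc L from rfl]
    have := cc_add_cc_add_one hL
    linear_combination (norm := ring_nf) -this
  · rw [WilsonRP.shift_apply_of_ne _ hij.symm, siteDiagSwap, Equiv.swap_apply_right,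
      mA_apply_left, mA_apply_right hij, Nat.cast_add, show ((L / 2 : ℕ) : ZMod L) = cc L from rfl,
      add_comm]

/-- **`θ B_t = A_{t+c+1}`** (odd `L`). -/
theorem siteDiagSwap_mA_shift (hL : Odd L) (hij : i ≠ j) (t : ℕ) :
    siteDiagSwap i j ((mA (L := L) i t).shift i) = mA i (t + L / 2 + 1) := by
  rw [siteDiagSwap_shift, Equiv.swap_apply_left, siteDiagSwap_mA hL hij, mA_shift_shift hij]

/-- `θ(A_t, i) = (B_{t+c}, j)`. -/
theorem edgeDiagSwap_mA (hL : Odd L) (hij : i ≠ j) (t : ℕ) :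
    edgeDiagSwap i j (mA (L := L) i t, i) = ((mA i (t + L / 2)).shift i, j) := by
  simp only [edgeDiagSwap, siteDiagSwap_mA hL hij, Equiv.swap_apply_left]

/-- `θ(B_t, j) = (A_{t+c+1}, i)`. -/
theorem edgeDiagSwap_mA_shift (hL : Odd L) (hij : i ≠ j) (t : ℕ) :
    edgeDiagSwap i j ((mA (L := L) i t).shift i, j) = (mA i (t + L / 2 + 1), i) := by
  simp only [edgeDiagSwap, siteDiagSwap_mA_shift hL hij, Equiv.swap_apply_right]

/-- **Every zigzag link is `(A_t, i)` or `(B_t, j)`** (`t = y_j`). -/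
theorem exists_eq_of_zm [NeZero L] (hij : i ≠ j) {e : Edge 2 L} (he : ZM i j e) :
    e = (mA i (e.1 j).val, i) ∨ e = ((mA i (e.1 j).val).shift i, j) := by
  obtain ⟨y, μ⟩ := e
  have hyj : ((y j).val : ZMod L) = y j := ZMod.natCast_zmod_val (y j)
  rcases he with ⟨hμ, hk⟩ | ⟨hμ, hk⟩ <;> simp only at hμ hk ⊢ <;> subst hμ
  · left
    refine Prod.ext ?_ rfl
    funext k
    dsimp only
    obtain hk' | hk' := ((by decide : ∀ a b c : Fin 2, a ≠ b → c = a ∨ c = b) μ j k hij) <;> rw [hk']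
    · rw [mA_apply_left, hyj, ← hk, kd]; ring
    · rw [mA_apply_right hij, hyj]
  · right
    refine Prod.ext ?_ rfl
    funext k
    dsimp only
    obtain hk' | hk' := ((by decide : ∀ a b c : Fin 2, a ≠ b → c = a ∨ c = b) i μ k hij) <;> rw [hk']
    · rw [WilsonRP.shift_apply_self, mA_apply_left, hyj]
      rw [kd] at hk
      linear_combination hk
    · rw [WilsonRP.shift_apply_of_ne _ hij.symm, mA_apply_right hij, hyj]

end Zigzag

/-! ## Partial holonomies and the rotation gauge -/

section Rotation

variable {L : ℕ} {i j : Fin 2} {G : Type*} [Group G]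

variable (i j) in
/-- The partial zigzag holonomy `R_t = C_{A_0} C_{A_1} ⋯ C_{A_{t-1}}` (`C_y = U(y,i) U(y+e_i,j)`). -/
def oR (U : GaugeConfig 2 L G) : ℕ → G
  | 0 => 1
  | t + 1 => oR U t * cT i j U (mA i t)

variable (i j) in
/-- The rotation gauge on the layer `c`: `h(A_t) = (R_{t+c} U(A_{t+c}, i))⁻¹ R_t`. -/
def ohA (U : GaugeConfig 2 L G) (t : ℕ) : G :=
  (oR i j U (t + L / 2) * U (mA i (t + L / 2), i))⁻¹ * oR i j U t

variable (i j) in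
/-- The rotation gauge on the layer `c + 1`: `h(B_t) = R_{t+c+1}⁻¹ (R_t U(A_t, i))`. -/
def ohB (U : GaugeConfig 2 L G) (t : ℕ) : G :=
  (oR i j U (t + L / 2 + 1))⁻¹ * (oR i j U t * U (mA i t, i))

variable (i j) in
/-- The rotation gauge as a function on sites (`1` off the layers `c` and `c + 1`). -/
def ohfun (U : GaugeConfig 2 L G) (y : Site 2 L) : G :=
  if kd i j y = cc L then ohA i j U (y j).val
  else if kd i j y = cc L + 1 then ohB i j U (y j).val else 1

/-- `R_{t+1} = R_t · U(A_t, i) U(B_t, j)`. -/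
theorem oR_succ (U : GaugeConfig 2 L G) (t : ℕ) :
    oR i j U (t + 1) = oR i j U t * (U (mA i t, i) * U ((mA i t).shift i, j)) := rfl

/-- `R_{s+L} = R_L R_s` (the loop closes after `L` transports). -/
theorem oR_add_L (U : GaugeConfig 2 L G) (s : ℕ) : oR i j U (s + L) = oR i j U L * oR i j U s := by
  induction s with
  | zero => simp [oR]
  | succ s ih =>
    rw [show s + 1 + L = (s + L) + 1 by omega, oR_succ, oR_succ, ih, mA_add_L, mul_assoc]

/-- `h(A_t)` is `L`-periodic. -/
theorem ohA_add_L (U : GaugeConfig 2 L G) (t : ℕ) : ohA i j U (t + L) = ohA i j U t := by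
  rw [ohA, ohA, show t + L + L / 2 = (t + L / 2) + L by omega, oR_add_L, oR_add_L, mA_add_L]
  group

/-- `h(B_t)` is `L`-periodic. -/
theorem ohB_add_L (U : GaugeConfig 2 L G) (t : ℕ) : ohB i j U (t + L) = ohB i j U t := by
  rw [ohB, ohB, show t + L + L / 2 + 1 = (t + L / 2 + 1) + L by omega, oR_add_L, oR_add_L,
    mA_add_L]
  group

/-- `h` at `A_t`. -/
theorem ohfun_mA (hij : i ≠ j) (U : GaugeConfig 2 L G) (t : ℕ) :
    ohfun i j U (mA i t) = ohA i j U t := by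
  have hp : Function.Periodic (ohA i j U) L := fun s => ohA_add_L U s
  rw [ohfun, if_pos (kd_mA hij t), mA_apply_right hij, ZMod.val_natCast, hp.map_mod_nat]

/-- `h` at `B_t` (`L ≥ 3`). -/
theorem ohfun_mA_shift (h3 : 3 ≤ L) (hij : i ≠ j) (U : GaugeConfig 2 L G) (t : ℕ) :
    ohfun i j U ((mA i t).shift i) = ohB i j U t := by
  have hp : Function.Periodic (ohB i j U) L := fun s => ohB_add_L U s
  have hne : kd i j ((mA (L := L) i t).shift i) ≠ cc L := by
    rw [kd_mA_shift hij]; exact cc_add_one_ne_cc h3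
  rw [ohfun, if_neg hne, if_pos (kd_mA_shift hij t), WilsonRP.shift_apply_of_ne _ hij.symm,
    mA_apply_right hij, ZMod.val_natCast, hp.map_mod_nat]

/-- **The zigzag link `(A_t, i)` is rotated by the gauge `h`**:
`h(A_t) U(A_t,i) h(B_t)⁻¹ = U(B_{t+c}, j) = U(θ(A_t, i))` (odd `L ≥ 3`). -/
theorem gauge_mA (hL : Odd L) (h3 : 3 ≤ L) (hij : i ≠ j) (U : GaugeConfig 2 L G) (t : ℕ) :
    ohfun i j U (mA i t) * U (mA i t, i) * (ohfun i j U ((mA i t).shift i))⁻¹ =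
      U (edgeDiagSwap i j (mA i t, i)) := by
  rw [ohfun_mA hij, ohfun_mA_shift h3 hij, edgeDiagSwap_mA hL hij, ohA, ohB, oR_succ]
  group

/-- **The zigzag link `(B_t, j)` is rotated by the gauge `h`**:
`h(B_t) U(B_t,j) h(A_{t+1})⁻¹ = U(A_{t+c+1}, i) = U(θ(B_t, j))` (odd `L ≥ 3`). -/
theorem gauge_mB (hL : Odd L) (h3 : 3 ≤ L) (hij : i ≠ j) (U : GaugeConfig 2 L G) (t : ℕ) :
    ohfun i j U ((mA i t).shift i) * U ((mA i t).shift i, j) *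
        (ohfun i j U (((mA i t).shift i).shift j))⁻¹ =
      U (edgeDiagSwap i j ((mA i t).shift i, j)) := by
  rw [mA_shift_shift hij, ohfun_mA hij, ohfun_mA_shift h3 hij, edgeDiagSwap_mA_shift hL hij, ohA,
    ohB, show t + 1 + L / 2 = t + L / 2 + 1 by omega, oR_succ U t]
  group

end Rotation

end DiagRPTwo

end

end Summit.QuantumFields.GaugeBoot
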